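import Mathlib
import HarnessLib

/-!
# RootDecomp1B — definitions for the POLAR FLAG reduction (lens-4 gen 7, node «PolarFlag»; round 7 of route RootDecomp1B)

Route-posited objects of lens 4's round 7 (critic-CLEARED node; see the Theorems files `RootDecomp1BFedFlagCore` and `RootDecomp1BFedFlag`,
which prove `FedKleinPolar ⟺ FedSharpStep ∧ FedSurplusOneStep` and the transfer `FedSharpStep → FedSurplusOneStep → BaseFedCoupling`
(stmt-Schanuel-30165) over them):
* `FedSharpStep`, `FedSurplusOneStep` — the two ONE-STEP FLAG statements (the node's proposed items, verbatim one-line texts; IH-local);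
* `KleinIH m` (Klein-polar Schanuel below length `m`), `polarDeg`, `baseField`, `IsFed`, `polarGens`, `polarField`, `LastFed` — the polar-budget
  vocabulary of route RootDecomp1B (B(r) = ℚ(r), F(r) = ℚ(r, ir, e^r, e^{ir}), t(r) = trdeg F(r));
* `FedKleinPolar` — Klein-polar Schanuel restricted to FED tuples, IH-local form (not an item).
Port (census seat, prover role) of the definitions of `HOME/decomp-schanuel-lens-4/g7/prover/RootDecomp1BFedFlagCore.port.lean` (= node PolarFlag.lean,
extracted by g7/extract_core7.py); Mathlib only; no theorems, no instances, no notation.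
-/

set_option linter.dupNamespace false

noncomputable section

namespace Summit.Schanuel.Schanuel.Theorems.RootDecomp1BFedFlagCore

/-- FED SHARP STEP (lens-4 g7 crux, rank 3; IH-local): for every `m`, every ℚ-free real `r` of length `m + 1` such that Klein-polar
Schanuel holds below length `m + 1`, `e^{u}` or `e^{iu}` is algebraic over ℚ(r) for the last coordinate `u = r (Fin.last m)`, and the polar
generators of the initial hyperplane `Fin.init r` have transcendence degree `≤ 2m` (SHARP), the polar generators of `r` have transcendence degree
`≥ 2m + 2` — «u and its non-fed exponential are algebraically independent over the polar field of a sharp Klein-polar hyperplane»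
(relative Hermite–Lindemann / Gel'fond–Schneider–Lang); first open cells (log 2 ∣ ∅), (1 ∣ π) = «e, e^i, π, e^π a.i.», (log 2 ∣ π). -/
def FedSharpStep : Prop :=
  ∀ (m : ℕ) (r : Fin (m + 1) → ℝ), LinearIndependent ℚ r →
    (∀ k, k < m + 1 → ∀ (s : Fin k → ℝ), LinearIndependent ℚ s →
      ((k + k : ℕ) : Cardinal) ≤ Algebra.trdeg ℚ ↥(IntermediateField.adjoin ℚ
        (Set.range (Fin.append (fun j => ((s j : ℝ) : ℂ)) (fun j => ((s j : ℝ) : ℂ) * Complex.I)) ∪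
          Set.range (Complex.exp ∘ Fin.append (fun j => ((s j : ℝ) : ℂ)) (fun j => ((s j : ℝ) : ℂ) * Complex.I))))) →
    (IsAlgebraic ↥(IntermediateField.adjoin ℚ (Set.range (fun j => ((r j : ℝ) : ℂ))))
        (Complex.exp ((r (Fin.last m) : ℝ) : ℂ)) ∨
      IsAlgebraic ↥(IntermediateField.adjoin ℚ (Set.range (fun j => ((r j : ℝ) : ℂ))))
        (Complex.exp (((r (Fin.last m) : ℝ) : ℂ) * Complex.I))) →
    Algebra.trdeg ℚ ↥(IntermediateField.adjoin ℚ
      (Set.range (Fin.append (fun j => ((Fin.init r j : ℝ) : ℂ)) (fun j => ((Fin.init r j : ℝ) : ℂ) * Complex.I)) ∪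
        Set.range (Complex.exp ∘
          Fin.append (fun j => ((Fin.init r j : ℝ) : ℂ)) (fun j => ((Fin.init r j : ℝ) : ℂ) * Complex.I)))) ≤
      ((m + m : ℕ) : Cardinal) →
    ((m + 1 + (m + 1) : ℕ) : Cardinal) ≤ Algebra.trdeg ℚ ↥(IntermediateField.adjoin ℚ
      (Set.range (Fin.append (fun j => ((r j : ℝ) : ℂ)) (fun j => ((r j : ℝ) : ℂ) * Complex.I)) ∪
        Set.range (Complex.exp ∘ Fin.append (fun j => ((r j : ℝ) : ℂ)) (fun j => ((r j : ℝ) : ℂ) * Complex.I))))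

/-- FED SURPLUS-ONE STEP (lens-4 g7 crux, rank 4; IH-local, dark): the same with the initial hyperplane of SURPLUS EXACTLY ONE
(polar transcendence degree `= 2m + 1`): then `u, e^u, e^{iu}` are not all algebraic over its polar field, i.e. the polar generators of `r`
have transcendence degree `≥ 2m + 2`; its hypothesis «hyperplane of surplus exactly one» is certified nowhere (no computable handle). -/
def FedSurplusOneStep : Prop :=
  ∀ (m : ℕ) (r : Fin (m + 1) → ℝ), LinearIndependent ℚ r →
    (∀ k, k < m + 1 → ∀ (s : Fin k → ℝ), LinearIndependent ℚ s →
      ((k + k : ℕ) : Cardinal) ≤ Algebra.trdeg ℚ ↥(IntermediateField.adjoin ℚ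
        (Set.range (Fin.append (fun j => ((s j : ℝ) : ℂ)) (fun j => ((s j : ℝ) : ℂ) * Complex.I)) ∪
          Set.range (Complex.exp ∘ Fin.append (fun j => ((s j : ℝ) : ℂ)) (fun j => ((s j : ℝ) : ℂ) * Complex.I))))) →
    (IsAlgebraic ↥(IntermediateField.adjoin ℚ (Set.range (fun j => ((r j : ℝ) : ℂ))))
        (Complex.exp ((r (Fin.last m) : ℝ) : ℂ)) ∨
      IsAlgebraic ↥(IntermediateField.adjoin ℚ (Set.range (fun j => ((r j : ℝ) : ℂ))))
        (Complex.exp (((r (Fin.last m) : ℝ) : ℂ) * Complex.I))) →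
    Algebra.trdeg ℚ ↥(IntermediateField.adjoin ℚ
      (Set.range (Fin.append (fun j => ((Fin.init r j : ℝ) : ℂ)) (fun j => ((Fin.init r j : ℝ) : ℂ) * Complex.I)) ∪
        Set.range (Complex.exp ∘
          Fin.append (fun j => ((Fin.init r j : ℝ) : ℂ)) (fun j => ((Fin.init r j : ℝ) : ℂ) * Complex.I)))) =
      ((m + m + 1 : ℕ) : Cardinal) →
    ((m + 1 + (m + 1) : ℕ) : Cardinal) ≤ Algebra.trdeg ℚ ↥(IntermediateField.adjoin ℚ
      (Set.range (Fin.append (fun j => ((r j : ℝ) : ℂ)) (fun j => ((r j : ℝ) : ℂ) * Complex.I)) ∪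
        Set.range (Complex.exp ∘ Fin.append (fun j => ((r j : ℝ) : ℂ)) (fun j => ((r j : ℝ) : ℂ) * Complex.I))))

/-- `KleinIH m`: Klein-polar Schanuel for every `ℚ`-free real tuple of every length `< m`. -/
def KleinIH (m : ℕ) : Prop :=
  ∀ k, k < m → ∀ (s : Fin k → ℝ), LinearIndependent ℚ s →
    ((k + k : ℕ) : Cardinal) ≤ Algebra.trdeg ℚ ↥(IntermediateField.adjoin ℚ
      (Set.range (Fin.append (fun j => ((s j : ℝ) : ℂ)) (fun j => ((s j : ℝ) : ℂ) * Complex.I)) ∪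
        Set.range (Complex.exp ∘ Fin.append (fun j => ((s j : ℝ) : ℂ)) (fun j => ((s j : ℝ) : ℂ) * Complex.I))))

/-- t(r) = trdeg_ℚ ℚ(r, i r, e^r, e^{i r}), the JOINT (polar) field. -/
def polarDeg {m : ℕ} (r : Fin m → ℝ) : Cardinal :=
  Algebra.trdeg ℚ ↥(IntermediateField.adjoin ℚ
    (Set.range (Fin.append (fun j => ((r j : ℝ) : ℂ)) (fun j => ((r j : ℝ) : ℂ) * Complex.I)) ∪
      Set.range (Complex.exp ∘ Fin.append (fun j => ((r j : ℝ) : ℂ)) (fun j => ((r j : ℝ) : ℂ) * Complex.I))))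

/-- The BASE FIELD `B(r) = ℚ(r₁, …, r_m) ⊂ ℂ` of a real tuple. -/
def baseField {m : ℕ} (r : Fin m → ℝ) : IntermediateField ℚ ℂ :=
  IntermediateField.adjoin ℚ (Set.range (fun j => ((r j : ℝ) : ℂ)))

/-- `r` is BASE-FED: some nonzero direction `v ∈ span_ℚ(r)` has `e^v` or `e^{iv}` algebraic over `B(r)`. -/
def IsFed (m : ℕ) (r : Fin m → ℝ) : Prop :=
  ∃ v ∈ Submodule.span ℚ (Set.range r), v ≠ 0 ∧
    (IsAlgebraic ↥(baseField r) (Complex.exp ((v : ℝ) : ℂ)) ∨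
      IsAlgebraic ↥(baseField r) (Complex.exp (((v : ℝ) : ℂ) * Complex.I)))

/-- The Schanuel generators of the polar tuple of `r`: `r, i r, e^r, e^{i r}`. -/
def polarGens {m : ℕ} (r : Fin m → ℝ) : Set ℂ :=
  Set.range (Fin.append (fun j => ((r j : ℝ) : ℂ)) (fun j => ((r j : ℝ) : ℂ) * Complex.I)) ∪
    Set.range (Complex.exp ∘ Fin.append (fun j => ((r j : ℝ) : ℂ)) (fun j => ((r j : ℝ) : ℂ) * Complex.I))

/-- The POLAR FIELD `F(r) = ℚ(r, i r, e^r, e^{i r}) ⊂ ℂ`; `polarDeg r = trdeg_ℚ F(r)` by `rfl`. -/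
def polarField {m : ℕ} (r : Fin m → ℝ) : IntermediateField ℚ ℂ :=
  IntermediateField.adjoin ℚ (polarGens r)

/-- The LAST coordinate is FED: `e^u` or `e^{u i}` is algebraic over the base field `B(r) = ℚ(r)`. -/
def LastFed (m : ℕ) (r : Fin (m + 1) → ℝ) : Prop :=
  IsAlgebraic ↥(baseField r) (Complex.exp ((r (Fin.last m) : ℝ) : ℂ)) ∨
    IsAlgebraic ↥(baseField r) (Complex.exp (((r (Fin.last m) : ℝ) : ℂ) * Complex.I))

/-- Klein-polar Schanuel RESTRICTED TO FED TUPLES, in IH-local (first-failure) form.  Not an item: the kernel proves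
`FedKleinPolar ⟺ FedSharpStep ∧ FedSurplusOneStep` and `FedKleinPolar ⟹ BaseFedCoupling`. -/
def FedKleinPolar : Prop :=
  ∀ (m : ℕ) (r : Fin m → ℝ), LinearIndependent ℚ r → KleinIH m → IsFed m r →
    ((m + m : ℕ) : Cardinal) ≤ polarDeg r

end Summit.Schanuel.Schanuel.Theorems.RootDecomp1BFedFlagCore
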